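import Literature.Probability.LatticeModels.PlaneRotatorLiebBoxCriterion
import HarnessLib

/-!
# Lieb's finite algorithm with ANISOTROPIC boxes: slab inside systems for layered plane rotators, and
# three-dimensional exponential decay from ONE number `S_{R∥,R⊥}`

E. H. Lieb, *A refinement of Simon's correlation inequality*, Comm. Math. Phys. **77** (1980) 127–135
[Lieb1980], eq. (23) and p. 128 ("`φ(β) < 1` for some `β` implies exponential decay ... taking `B` to be the
boundary of a sufficiently large box"); B. Simon, Comm. Math. Phys. **77** (1980) 111, Thm 1.3 [Simon1980CMP].
`PlaneRotatorLiebBoxCriterion.lean` runs the algorithm with the cubes `[−R, R]^ν`. For the LAYERED XY model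
(in-plane `J∥`, inter-layer `J⊥ ≪ J∥`; L. L. Liu, H. E. Stanley 1972 [LiuStanley1972]) the natural inside system
is a SLAB: radius `R` in the plane, radius `1` across the layers — the box version of the inside system
"layer + dangling vertical bonds" of the layer-decoupling theorem (`LayeredPlaneRotatorDecoupling.lean`). This
file runs Lieb's algorithm with a general radius vector `Rv : Fin ν → ℕ` (all `≥ 1`):

* `abox Rv = ∏ [−R_i, R_i]`, `aInterior Rv = ∏ (−R_i, R_i)`, the shell = box minus interior, `aIndex Rv y =
  max_i ⌊|y_i| / R_i⌋` (the anisotropic floor-distance), `aboxShellSum Jf Rv` = **Lieb's number**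
  `S_{Rv} = ∑_{b ∈ shell} ⟨cos(θ_0 − θ_b)⟩_{box, shell free}` (ONE finite-dimensional integral).
* `twoPoint_le_pow_aboxShellSum` — for a translation-invariant ferromagnetic pair coupling of `ℓ^∞`-range `1` and
  EVERY finite `Λ ⊂ ℤ^ν`: `⟨cos(θ_a − θ_c)⟩_Λ ≤ S_{Rv}^{max_i ⌊|a_i − c_i|/R_i⌋}`.
* `slabShellSum β J∥ J⊥ R` (`Rv = (R, R, 1)` on `ℤ³`) and **`twoPoint_layered_le_pow_slabShellSum`**:
  `⟨cos(θ_a − θ_c)⟩_{Λ,β} ≤ S^{slab}_R(β; J∥, J⊥)^{max(⌊|Δ₁|/R⌋, ⌊|Δ₂|/R⌋, |Δℓ|)}`, with the corollary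
  `twoPoint_layered_le_pow_slabShellSum_layer` (exponent `|ℓ(a) − ℓ(c)|`, the shape of the layer-decoupling bound).
  In the slab reference system the layers `±1` carry no bonds of their own (shell–shell bonds are in `H_C`), so they
  are vertical LEAVES on the interior `(2R−1)²` block and (two-spin lemma) `S^{slab}_R = S_R^{2D}(βJ∥) +
  2u(βJ⊥)·∑_{y ∈ interior} ⟨cos(θ_0 − θ_y)⟩_{2D box}`, `u = I₁/I₀` — a number of the two-dimensional box alone
  (this evaluation is numerics, not formalised here); `R = 1` is the star `4u(βJ∥) + 2u(βJ⊥)`.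

Cell use (`pub/hubbard-tc`, MO-S3, keys K4-c/K5, INTERLAYER L3): `k_B T_c^{3D-XY}(J∥, J⊥) ≤ T` as soon as
`S^{slab}_R(1/T; J∥, J⊥) < 1` for some `R` — one certifiable number per `(T, J∥, J⊥, R)`, sharp as `J⊥ → 0`
(`→ S_R^{2D}`) where the susceptibility route `βJ⊥·X_R(S_R)` of `LayeredPlaneRotatorBoxDecoupling.lean` degrades.
Classical effective model only (K5); finite volume; no `T_c` object; no numerics here.
-/

noncomputable section

open MeasureTheory Finset
open scoped BigOperators

namespace Literature.Probability.LatticeModels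

namespace PlaneRotator

/-! ### Anisotropic boxes in `ℤ^ν` -/

section AnisotropicBoxes

open Literature.Barriers.CriticalPhenomena Literature.Barriers.CriticalPhenomena.LongRangeIsing

variable {ν : ℕ}

omit ν in
/-- `‖x − y‖_∞ = ‖y − x‖_∞` (tree `Site.supNorm`). [folklore] -/
private theorem supNorm_sub_comm'' {ν : ℕ} (x y : Site ν) : Site.supNorm (x - y) = Site.supNorm (y - x) := by
  rw [← neg_sub, Site.supNorm_neg]

/-- The **anisotropic reference box** `∏_i [−R_i, R_i] ⊂ ℤ^ν` (`Rv = (R, …, R)` is the tree's `box ν R`).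
[cite: Lieb1980, p. 128 (B the boundary of a box)] -/
def abox (Rv : Fin ν → ℕ) : Finset (Site ν) := Fintype.piFinset fun i => Finset.Icc (-(Rv i : ℤ)) (Rv i)

/-- Its **interior** `∏_i (−R_i, R_i)`: the sites all of whose `ℓ^∞`-neighbours stay in the box.
[cite: Lieb1980, p. 128 (B the boundary of a box)] -/
def aInterior (Rv : Fin ν → ℕ) : Finset (Site ν) := Fintype.piFinset fun i => Finset.Ioo (-(Rv i : ℤ)) (Rv i)

/-- Membership in the anisotropic box: `|y_i| ≤ R_i` for all `i`. [cite: Lieb1980, p. 128 (B the boundary of a box)] -/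
theorem mem_abox {Rv : Fin ν → ℕ} {y : Site ν} : y ∈ abox Rv ↔ ∀ i, (y i).natAbs ≤ Rv i := by
  rw [abox, Fintype.mem_piFinset]
  refine forall_congr' fun i => ?_
  rw [Finset.mem_Icc]
  omega

/-- Membership in the interior: `|y_i| < R_i` for all `i`. [cite: Lieb1980, p. 128 (B the boundary of a box)] -/
theorem mem_aInterior {Rv : Fin ν → ℕ} {y : Site ν} : y ∈ aInterior Rv ↔ ∀ i, (y i).natAbs < Rv i := by
  rw [aInterior, Fintype.mem_piFinset]
  refine forall_congr' fun i => ?_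
  rw [Finset.mem_Ioo]
  omega

/-- The interior lies in the box. [cite: Lieb1980, p. 128 (B the boundary of a box)] -/
theorem aInterior_subset_abox (Rv : Fin ν → ℕ) : aInterior Rv ⊆ abox Rv := fun _ hy =>
  mem_abox.2 fun i => (mem_aInterior.1 hy i).le

/-- The interior is symmetric under `y ↦ −y`. [cite: Lieb1980, p. 128 (B the boundary of a box)] -/
theorem neg_mem_aInterior {Rv : Fin ν → ℕ} (y : Site ν) : -y ∈ aInterior Rv ↔ y ∈ aInterior Rv := by
  simp only [mem_aInterior, Pi.neg_apply, Int.natAbs_neg]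

/-- The origin is in the box. [cite: Lieb1980, p. 128 (B the boundary of a box)] -/
theorem zero_mem_abox (Rv : Fin ν → ℕ) : (0 : Site ν) ∈ abox Rv := mem_abox.2 fun i => by simp

/-- The **anisotropic floor-distance** `max_i ⌊|y_i| / R_i⌋` — the number of nested `Rv`-shells a bond path from
`0` to `y` must cross. [cite: Lieb1980, p. 128 (boxes; exponential decay); Simon1980CMP, Thm 1.3] -/
def aIndex (Rv : Fin ν → ℕ) (y : Site ν) : ℕ := Finset.univ.sup fun i => (y i).natAbs / Rv i

/-- Each coordinate quotient is bounded by the index. [cite: Simon1980CMP, Thm 1.3] -/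
theorem div_le_aIndex (Rv : Fin ν → ℕ) (y : Site ν) (i : Fin ν) : (y i).natAbs / Rv i ≤ aIndex Rv y :=
  Finset.le_sup (f := fun i => (y i).natAbs / Rv i) (Finset.mem_univ i)

/-- For radii `≥ 1`, the index vanishes exactly on the interior. [cite: Lieb1980, p. 128 (B the boundary of a box)] -/
theorem aIndex_eq_zero_iff {Rv : Fin ν → ℕ} (hR : ∀ i, 1 ≤ Rv i) {y : Site ν} :
    aIndex Rv y = 0 ↔ y ∈ aInterior Rv := by
  rw [mem_aInterior, aIndex, ← Nat.le_zero, Finset.sup_le_iff]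
  refine forall_congr' fun i => ?_
  simp only [Finset.mem_univ, true_implies, Nat.le_zero]
  exact Nat.div_eq_zero_iff_lt (hR i)

/-- The index drops by at most one across a box: if `|x_i − b_i| ≤ R_i` for all `i` then
`aIndex(x − c) ≤ aIndex(b − c) + 1`. [cite: Simon1980CMP, Thm 1.3] -/
theorem aIndex_sub_le_succ {Rv : Fin ν → ℕ} (hR : ∀ i, 1 ≤ Rv i) {x b c : Site ν}
    (h : ∀ i, ((x - b) i).natAbs ≤ Rv i) : aIndex Rv (x - c) ≤ aIndex Rv (b - c) + 1 := by
  unfold aIndex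
  refine Finset.sup_le fun i _ => ?_
  have htri : ((x - c) i).natAbs ≤ ((b - c) i).natAbs + Rv i := by
    have := Int.natAbs_add_le ((x - b) i) ((b - c) i)
    rw [show (x - b) i + (b - c) i = (x - c) i by simp [Pi.sub_apply]] at this
    have hi := h i
    omega
  calc ((x - c) i).natAbs / Rv i ≤ (((b - c) i).natAbs + Rv i) / Rv i := Nat.div_le_div_right htri
    _ = ((b - c) i).natAbs / Rv i + 1 := Nat.add_div_right _ (hR i)
    _ ≤ (Finset.univ.sup fun j => ((b - c) j).natAbs / Rv j) + 1 :=
        Nat.add_le_add_right (Finset.le_sup (f := fun j => ((b - c) j).natAbs / Rv j) (Finset.mem_univ i)) 1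

/-- `ℓ^∞`-range one: a neighbour of an interior point of the box `x + abox` lies in the box. [cite: Lieb1980, p. 128 (B the boundary of a box)] -/
theorem sub_mem_abox_of_interior {Rv : Fin ν → ℕ} {x y z : Site ν} (hyz : Site.supNorm (y - z) ≤ 1)
    (hy : y - x ∈ aInterior Rv) : z - x ∈ abox Rv := by
  rw [mem_abox]; rw [mem_aInterior] at hy
  intro i
  have h1 : ((z - y) i).natAbs ≤ 1 := by
    have := Site.natAbs_le_supNorm (z - y) i
    rw [supNorm_sub_comm''] at hyz
    exact this.trans hyz
  have htri := Int.natAbs_add_le ((z - y) i) ((y - x) i)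
  rw [show (z - y) i + (y - x) i = (z - x) i by simp [Pi.sub_apply]] at htri
  have := hy i
  omega

/-- The centre `0` of the anisotropic reference box. [cite: Lieb1980, p. 128 (B the boundary of a box)] -/
def aCentre (Rv : Fin ν → ℕ) : abox Rv := ⟨0, zero_mem_abox Rv⟩

/-- The **shell** of the anisotropic box: its sites outside the interior (Lieb's separating set `B`).
[cite: Lieb1980, p. 128 (B the boundary of a box)] -/
def aShell (Rv : Fin ν → ℕ) : Finset (abox Rv) := Finset.univ.filter fun b => (b : Site ν) ∉ aInterior Rv

/-- The **reference inside system** on the anisotropic box: the couplings `Jf`, shell–shell bonds removed.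
[cite: Lieb1980, eqs. (4)–(5) and p. 133 (B–B interactions part of H_C)] -/
def aRefCoupling (Jf : Site ν → Site ν → ℝ) (Rv : Fin ν → ℕ) (p : abox Rv × abox Rv) : ℝ :=
  if (p.1 : Site ν) ∉ aInterior Rv ∧ (p.2 : Site ν) ∉ aInterior Rv then 0 else Jf p.1 p.2

omit ν in
/-- The reference couplings are non-negative when `Jf` is. [cite: Lieb1980, eqs. (4)–(5) and p. 132 (J_{ab} ≥ 0)] -/
theorem aRefCoupling_nonneg {ν : ℕ} {Jf : Site ν → Site ν → ℝ} (hJf0 : ∀ x y, 0 ≤ Jf x y) (Rv : Fin ν → ℕ)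
    (p : abox Rv × abox Rv) : 0 ≤ aRefCoupling Jf Rv p := by
  unfold aRefCoupling; split_ifs <;> [exact le_rfl; exact hJf0 _ _]

variable [MeasurableSpace Circle] [BorelSpace Circle]

/-- **Lieb's number for the anisotropic box** `S_{Rv}(Jf) = ∑_{b ∈ shell} ⟨cos(θ_0 − θ_b)⟩_{∏[−R_i,R_i], shell free}`
— ONE finite-dimensional integral. [cite: Lieb1980, p. 128 (φ(β) < 1 for a box ⇒ exponential decay; finite algorithm)] -/
def aboxShellSum (Jf : Site ν → Site ν → ℝ) (Rv : Fin ν → ℕ) : ℝ :=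
  ∑ b ∈ aShell Rv, twoPoint (aRefCoupling Jf Rv) (aCentre Rv) b

/-- `S_{Rv} ≥ 0` (Griffiths' first inequality). [cite: Lieb1980, p. 128 (φ(β)); Ginibre1970, Example 4 (plane rotators)] -/
theorem aboxShellSum_nonneg {Jf : Site ν → Site ν → ℝ} (hJf0 : ∀ x y, 0 ≤ Jf x y) (Rv : Fin ν → ℕ) :
    0 ≤ aboxShellSum Jf Rv :=
  Finset.sum_nonneg fun b _ => twoPoint_nonneg (aRefCoupling_nonneg hJf0 Rv) _ b

/-! ### The anisotropic box criterion on every finite `Λ ⊂ ℤ^ν` -/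

/-- **Lieb's box criterion with anisotropic boxes, finite-volume form.** Let `Jf ≥ 0` be a translation-invariant pair
coupling on `ℤ^ν` of `ℓ^∞`-range `1`, `R_i ≥ 1` for all `i`, and let the model on a finite `Λ ⊂ ℤ^ν` (free boundary
conditions) have couplings `J(x,y) = Jf(x,y)`. Then for all `a, c ∈ Λ`:

  `⟨cos(θ_a − θ_c)⟩_Λ ≤ S_{Rv}^{max_i ⌊|a_i − c_i| / R_i⌋}`,  `S_{Rv} = aboxShellSum Jf Rv`.

((23) with the inside system `(x + ∏[−R_i, R_i]) ∩ Λ`, shell = box minus interior; comparison of the partial boxes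
with the reference box by `y ↦ y − x` (Griffiths–Ginibre); Simon's iteration with `d = max_i ⌊|y_i − c_i|/R_i⌋`.)
Hence `S_{Rv} < 1` for ONE radius vector certifies exponential decay, uniformly in `Λ`.
[cite: Lieb1980, eq. (23), Theorem 4 and p. 128 (boxes); Simon1980CMP, Thm 1.3] -/
theorem twoPoint_le_pow_aboxShellSum {Jf : Site ν → Site ν → ℝ} (hJf0 : ∀ x y, 0 ≤ Jf x y)
    (hJfr : ∀ x y, Jf x y ≠ 0 → Site.supNorm (x - y) ≤ 1) (hJft : ∀ t x y, Jf (x - t) (y - t) = Jf x y)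
    {Rv : Fin ν → ℕ} (hR : ∀ i, 1 ≤ Rv i) (Λ : Finset (Site ν)) {J : Λ × Λ → ℝ}
    (hJ : ∀ p, J p = Jf (p.1 : Site ν) (p.2 : Site ν)) (a c : Λ) :
    twoPoint J a c ≤ aboxShellSum Jf Rv ^ aIndex Rv ((a : Site ν) - (c : Site ν)) := by
  classical
  have hJ0 : ∀ p, 0 ≤ J p := fun p => by rw [hJ]; exact hJf0 _ _
  -- boxes and shells inside `Λ`
  set A : Λ → Finset Λ := fun x => Finset.univ.filter fun y : Λ => (y : Site ν) - (x : Site ν) ∈ abox Rv with hAdef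
  set S : Λ → Finset Λ := fun x => Finset.univ.filter fun y : Λ =>
    (y : Site ν) - (x : Site ν) ∈ abox Rv ∧ (y : Site ν) - (x : Site ν) ∉ aInterior Rv with hSdef
  have memA : ∀ x y : Λ, y ∈ A x ↔ (y : Site ν) - (x : Site ν) ∈ abox Rv := fun x y => by simp [hAdef]
  have memS : ∀ x y : Λ, y ∈ S x ↔
      (y : Site ν) - (x : Site ν) ∈ abox Rv ∧ (y : Site ν) - (x : Site ν) ∉ aInterior Rv := fun x y => by
    simp [hSdef]
  have hbond : ∀ p : Λ × Λ, J p ≠ 0 → Site.supNorm ((p.1 : Site ν) - (p.2 : Site ν)) ≤ 1 := fun p hp => by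
    rw [hJ] at hp; exact hJfr _ _ hp
  have hxA0 : ∀ x : Λ, x ∈ A x := fun x => by rw [memA, sub_self]; exact zero_mem_abox Rv
  refine twoPoint_le_pow_of_shell_rowSum_le hJ0 A S (fun x y hy => ?_) hxA0 (fun x p hp => ?_)
    (s := aboxShellSum Jf Rv) (fun x => ?_) c (d := fun y : Λ => aIndex Rv ((y : Site ν) - (c : Site ν)))
    (fun x hx hcA => ?_) (fun x b hb => ?_) a
  · -- `S x ⊆ A x`
    rw [memA]; exact ((memS x y).1 hy).1
  · -- every bond leaving the box starts on the shell (range one)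
    have h1 := hbond p hp
    constructor
    · intro hin hout
      rw [memA] at hin hout; rw [memS]
      refine ⟨hin, fun hint => hout ?_⟩
      exact sub_mem_abox_of_interior h1 hint
    · intro hin hout
      rw [memA] at hin hout; rw [memS]
      refine ⟨hin, fun hint => hout ?_⟩
      rw [supNorm_sub_comm''] at h1
      exact sub_mem_abox_of_interior h1 hint
  · -- the shell row sum of the partial box is at most `S_{Rv}` (translate into the reference box)
    let τ : Λ → abox Rv := fun y =>
      if h : (y : Site ν) - (x : Site ν) ∈ abox Rv then ⟨(y : Site ν) - (x : Site ν), h⟩ else aCentre Rv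
    have hτ_val : ∀ y : Λ, y ∈ A x → ((τ y : abox Rv) : Site ν) = (y : Site ν) - (x : Site ν) := fun y hy => by
      rw [memA] at hy
      simp only [τ, dif_pos hy]
    have hτx : τ x = aCentre Rv := by
      apply Subtype.ext
      rw [hτ_val x (hxA0 x), sub_self]
      rfl
    have hτinj : Set.InjOn τ (A x) := by
      intro y hy z hz hyz
      have h : ((τ y : abox Rv) : Site ν) = ((τ z : abox Rv) : Site ν) := congrArg _ hyz
      rw [hτ_val y hy, hτ_val z hz] at h
      exact Subtype.ext (sub_left_injective h)
    have hτS : ∀ b : Λ, b ∈ S x → τ b ∈ aShell Rv := fun b hb => by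
      have hbA : b ∈ A x := by rw [memA]; exact ((memS x b).1 hb).1
      simp only [aShell, Finset.mem_filter, Finset.mem_univ, true_and]
      rw [hτ_val b hbA]
      exact ((memS x b).1 hb).2
    have hdom : ∀ y ∈ A x, ∀ z ∈ A x,
        insideCoupling J (A x) (S x) (y, z) ≤ aRefCoupling Jf Rv (τ y, τ z) := by
      intro y hy z hz
      by_cases hS : y ∈ S x ∧ z ∈ S x
      · rw [insideCoupling_of_shell (A := A x) hS.1 hS.2]
        exact aRefCoupling_nonneg hJf0 Rv _
      · rw [insideCoupling_of_mem (p := (y, z)) hy hz hS, hJ]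
        unfold aRefCoupling
        rw [if_neg, hτ_val y hy, hτ_val z hz, hJft]
        simp only [hτ_val y hy, hτ_val z hz]
        rw [memS, memS] at hS
        rw [memA] at hy hz
        exact fun h => hS ⟨⟨hy, h.1⟩, ⟨hz, h.2⟩⟩
    calc ∑ b ∈ S x, twoPoint (insideCoupling J (A x) (S x)) x b
        ≤ ∑ b ∈ S x, twoPoint (aRefCoupling Jf Rv) (aCentre Rv) (τ b) := by
          refine Finset.sum_le_sum fun b hb => ?_
          have hbA : b ∈ A x := by rw [memA]; exact ((memS x b).1 hb).1
          have h := twoPoint_le_of_injOn (insideCoupling_nonneg hJ0 (A x) (S x))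
            (insideCoupling_support J (A x) (S x)) τ hτinj (aRefCoupling_nonneg hJf0 Rv) hdom (hxA0 x) hbA
          rwa [hτx] at h
      _ = ∑ b' ∈ (S x).image τ, twoPoint (aRefCoupling Jf Rv) (aCentre Rv) b' := by
          rw [Finset.sum_image]
          intro y hy z hz hyz
          exact hτinj ((memA x y).2 ((memS x y).1 hy).1) ((memA x z).2 ((memS x z).1 hz).1) hyz
      _ ≤ aboxShellSum Jf Rv := by
          refine Finset.sum_le_sum_of_subset_of_nonneg (fun b' hb' => ?_)
            fun b' _ _ => twoPoint_nonneg (aRefCoupling_nonneg hJf0 Rv) _ _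
          obtain ⟨b, hb, rfl⟩ := Finset.mem_image.1 hb'
          exact hτS b hb
  · -- `d x ≠ 0` forces `c` out of the interior of the box of `x`
    rw [memS]; rw [memA] at hcA
    refine ⟨hcA, fun hint => hx ?_⟩
    rw [aIndex_eq_zero_iff hR, ← neg_mem_aInterior, neg_sub]
    exact hint
  · -- `d` drops by at most one across a shell
    have hbA := ((memS x b).1 hb).1
    rw [mem_abox] at hbA
    refine aIndex_sub_le_succ hR fun i => ?_
    rw [← Int.natAbs_neg, show -(((x : Site ν) - (b : Site ν)) i) = ((b : Site ν) - (x : Site ν)) i by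
      simp [Pi.sub_apply]]
    exact hbA i

/-! ### The layered XY model on `ℤ³`: slabs of radius `R` in the plane and `1` across the layers -/

/-- The radius vector `(R, R, 1)` of a SLAB: in-plane radius `R`, one layer up and down.
[cite: LiuStanley1972, p. 272 (layers (J, J, εJ)); Lieb1980, p. 128 (boxes)] -/
def slabRadii (R : ℕ) : Fin 3 → ℕ := ![R, R, 1]

omit ν [MeasurableSpace Circle] [BorelSpace Circle] in
/-- All slab radii are `≥ 1` when `R ≥ 1`. [folklore] -/
private theorem one_le_slabRadii {R : ℕ} (hR : 1 ≤ R) (i : Fin 3) : 1 ≤ slabRadii R i := by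
  fin_cases i <;> simp [slabRadii, hR]

omit ν in
/-- **Lieb's slab number for the layered XY model** `S^{slab}_R(β; J∥, J⊥) = ∑_{b ∈ shell} ⟨cos(θ_0 − θ_b)⟩` in the
reference system `[−R,R]² × {−1,0,1}` with couplings `βJ∥/2`, `βJ⊥/2` per ordered bond and all shell–shell bonds removed
(so the layers `±1` are vertical leaves on the interior `(2R−1)²` block: by the two-spin lemma
`S^{slab}_R = S_R^{2D}(βJ∥) + 2·I₁(βJ⊥)/I₀(βJ⊥)·∑_{y ∈ interior} ⟨cos(θ_0 − θ_y)⟩_{2D box}` — evaluated numerically, not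
here). `R = 1`: the star, `4u(βJ∥) + 2u(βJ⊥)`. [cite: Lieb1980, Theorem 4 and p. 128 (boxes); LiuStanley1972, p. 272 (layers (J, J, εJ))] -/
def slabShellSum (β Jp Jz : ℝ) (R : ℕ) : ℝ :=
  aboxShellSum (fun x y : Site 3 => β / 2 * layeredCoupling Jp Jz x y) (slabRadii R)

omit ν in
/-- **Lieb's slab criterion for the layered XY model on `ℤ³`.** For `β, J∥, J⊥ ≥ 0`, `R ≥ 1`, every finite
`Λ ⊂ ℤ³` (free boundary conditions) and `a, c ∈ Λ`:

  `⟨cos(θ_a − θ_c)⟩_{Λ,β} ≤ S^{slab}_R(β; J∥, J⊥)^{max(⌊|a₀−c₀|/R⌋, ⌊|a₁−c₁|/R⌋, |a₂−c₂|)}`.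

So `S^{slab}_R(1/T; J∥, J⊥) < 1` for one `R` certifies exponential decay in all directions, uniformly in the
volume: `k_B T_c^{3D-XY}(J∥, J⊥) ≤ T` in the finite-volume sense — one certifiable number per `(T, J∥, J⊥, R)`,
reducing to the two-dimensional box number `S_R(βJ∥)` as `J⊥ → 0`. (Cell `pub/hubbard-tc`, keys K4-c/K5:
classical effective model only.) [cite: Lieb1980, eq. (23), Theorem 4 and p. 128 (boxes; finite algorithm); Simon1980CMP, Thm 1.3] -/
theorem twoPoint_layered_le_pow_slabShellSum {β Jp Jz : ℝ} (hβ : 0 ≤ β) (hp : 0 ≤ Jp) (hz : 0 ≤ Jz) {R : ℕ}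
    (hR : 1 ≤ R) (Λ : Finset (Site 3)) (a c : Λ) :
    twoPoint (layeredXYCoupling β Jp Jz Λ) a c ≤
      slabShellSum β Jp Jz R ^ aIndex (slabRadii R) ((a : Site 3) - (c : Site 3)) := by
  refine twoPoint_le_pow_aboxShellSum (Jf := fun x y : Site 3 => β / 2 * layeredCoupling Jp Jz x y)
    (fun x y => mul_nonneg (by positivity) (layeredCoupling_nonneg hp hz _ _)) (fun x y hxy => ?_)
    (fun t x y => ?_) (one_le_slabRadii hR) Λ (fun p => rfl) a c
  · have h1 : l1Norm (x - y) = 1 := by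
      by_contra h
      exact hxy (by unfold layeredCoupling; rw [if_neg h, mul_zero])
    refine (Site.supNorm_le_iff.2 fun i => ?_).trans h1.le
    exact Finset.single_le_sum (f := fun i => ((x - y) i).natAbs) (fun _ _ => Nat.zero_le _) (Finset.mem_univ i)
  · simp only [sub_eq_add_neg, layeredCoupling_add]

omit ν in
/-- **Decay across the layers from the slab number** (the shape of the layer-decoupling bound of
`LayeredPlaneRotatorDecoupling.lean`, with `βJ⊥χ` replaced by ONE number): if `S^{slab}_R(β; J∥, J⊥) ≤ 1` then
`⟨cos(θ_a − θ_c)⟩_{Λ,β} ≤ S^{slab}_R ^ {|ℓ(a) − ℓ(c)|}` for every finite `Λ ⊂ ℤ³` and `a, c ∈ Λ`.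
[cite: Lieb1980, eq. (23) and p. 128 (boxes); LiuStanley1972, p. 272 (layers (J, J, εJ))] -/
theorem twoPoint_layered_le_pow_slabShellSum_layer {β Jp Jz : ℝ} (hβ : 0 ≤ β) (hp : 0 ≤ Jp) (hz : 0 ≤ Jz)
    {R : ℕ} (hR : 1 ≤ R) (hS1 : slabShellSum β Jp Jz R ≤ 1) (Λ : Finset (Site 3)) (a c : Λ) :
    twoPoint (layeredXYCoupling β Jp Jz Λ) a c ≤
      slabShellSum β Jp Jz R ^ (((a : Site 3) - (c : Site 3)) 2).natAbs := by
  have hS0 : 0 ≤ slabShellSum β Jp Jz R :=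
    aboxShellSum_nonneg (fun x y => mul_nonneg (by positivity) (layeredCoupling_nonneg hp hz _ _)) _
  refine (twoPoint_layered_le_pow_slabShellSum hβ hp hz hR Λ a c).trans (pow_le_pow_of_le_one hS0 hS1 ?_)
  have h := div_le_aIndex (slabRadii R) ((a : Site 3) - (c : Site 3)) 2
  simpa [slabRadii] using h

end AnisotropicBoxes

end PlaneRotator

end Literature.Probability.LatticeModels

end
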